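import Literature.MathematicalPhysics.QuantumLattice.ApproximatingHamiltonianProofs
import HarnessLib

/-!
# The Peierls–Feynman–Bogoliubov optimal LOCAL Hubbard model of an extended (U–V) Hamiltonian
(Schüler–Rösner–Wehling–Lichtenstein–Katsnelson 2013; van Loon–Schüler–Katsnelson–Wehling 2016)

An ab-initio one-band Hamiltonian for a cuprate / nickelate carries an on-site repulsion `U` AND
off-site terms `V_ij` (cRPA: `V₁/U ≈ 0.2–0.25`), while the model that is certified downstream is the
U-only Hubbard model. The printed rule for the map «extended ↦ local» is the
Peierls–Feynman–Bogoliubov (PFB) variational principle: among local surrogates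
`H⋆(Ũ) = T + Ũ·D̂` choose `Ũ` minimising `Φ̃(Ũ) = F(H⋆) + ⟨H − H⋆⟩_{H⋆}`, which bounds the true
free energy of `H = T + U·D̂ + V̂` from above; stationarity gives Schüler's formula
`U⋆ = U + ∂_Ũ⟨V̂⟩⋆ / ∂_Ũ⟨D̂⟩⋆` ([SchulerEtAl2013] Eq. (3)), i.e. `U⋆ = U − V̄` with `V̄` a weighted
average of the `V_0j`, `≈ U − V₀₁` near half filling (Eq. (5)); [vanLoonEtAl2016] §2–§3 writes it as
`Ũ = U − α(Ũ) V` and measures `α`.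

This file PROVES, for finite-dimensional (matrix) Hamiltonians:

* §1 `PFB.freeEnergy_le_add_re_gibbsState` — the PFB inequality in free-energy form,
  `F_β(H) ≤ F_β(K) + Re ⟨H − K⟩_{β,K}` for Hermitian `H`, `K`, `β > 0`, from the tree's
  partition-function form `Matrix.peierls_bogoliubov` (`DuhamelTwoPoint.lean`). [SchulerEtAl2013, Eq. (2)]
* §2 `PFB.freeEnergy_ext_le_functional` — for the Hubbard pair `H = T + U·D + V`,
  `K(Ũ) = T + Ũ·D` (any Hermitian matrices `T`, `D`, `V`): `F_β(H) ≤ Φ̃(Ũ)` for EVERY `Ũ`, with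
  `Φ̃(Ũ) = F_β(K(Ũ)) + (U − Ũ)·Re⟨D⟩_{K(Ũ)} + Re⟨V⟩_{K(Ũ)}`. [SchulerEtAl2013, Eq. (2) specialised]
* §3 `PFB.hasDerivAt_freeEnergy_loc` — the thermal Hellmann–Feynman theorem
  `d/dŨ F_β(T + Ũ·D) = Re⟨D⟩_{β, T + Ũ·D}` (Duhamel, `hasDerivAt_re_trace_exp_add_smul`). [folklore]
* §4 `PFB.hasDerivAt_functional` — `Φ̃′(Ũ) = (U − Ũ)·∂⟨D⟩ + ∂⟨V⟩` (the `⟨D⟩` terms cancel by §3),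
  and `PFB.stationary_iff` — `Φ̃′(Ũ) = 0 ↔ Ũ = U + ∂⟨V⟩/∂⟨D⟩` when `∂⟨D⟩ ≠ 0`. [SchulerEtAl2013, Eq. (3)]
* §5 `PFB.optimalU_nn_displacement` — the printed nearest-neighbour-displacement evaluation
  `U⋆ = U − V₀₁` (Eq. (5)) as the arithmetic identity it is under the stated sum rule.
* §6 (appended) `PFB.groundEnergy_ext_le` / `PFB.groundEnergy_loc_le_ext` / `PFB.groundEnergy_ext_mem_Icc` —
  the `β → ∞` form: `E₀(T + U·D + V) ≤ E₀(K(Ũ)) + (U − Ũ)·ω_{K(Ũ)}(D) + ω_{K(Ũ)}(V)` for every `Ũ`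
  (tracial ground state of the surrogate as trial state) and, for `V ⪰ 0`, the two-sided enclosure
  `E₀(K(U)) ≤ E₀(H) ≤ E₀(K(U)) + ω_{K(U)}(V)` by U-only data.

No definition of a physical model is introduced beyond the two reals-valued functionals; no facts
(`def … : Prop`) — everything is a theorem. WHAT THIS IS NOT: a statement that the local model
reproduces the extended model's observables (printed limits: charge order / stripes,
[SchulerEtAl2013] p. 4; `α(Ũ) = 1` only for `Ũ ≫ t`, [vanLoonEtAl2016] §3).

## References
* M. Schüler, M. Rösner, T. O. Wehling, A. I. Lichtenstein, M. I. Katsnelson, *Optimal Hubbard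
  models for materials with nonlocal Coulomb interactions*, Phys. Rev. Lett. 111, 036601 (2013),
  arXiv:1302.1437, Eqs. (2), (3), (5). [SchulerEtAl2013]
* E. G. C. P. van Loon, M. Schüler, M. I. Katsnelson, T. O. Wehling, *Capturing nonlocal
  interaction effects in the Hubbard model: Optimal mappings and limits of applicability*,
  Phys. Rev. B 94, 165141 (2016), arXiv:1605.09140, §2 Eqs. (3)–(6), §3. [vanLoonEtAl2016]
* O. Bratteli, D. W. Robinson, *Operator Algebras and Quantum Statistical Mechanics II*, 2nd ed.
  (1997), §5.3.1 (Gibbs states), Cor. 5.3.x / Peierls–Bogoliubov. [BratteliRobinsonII1997]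
-/

noncomputable section

open scoped Matrix.Norms.L2Operator ComplexOrder
open Matrix NormedSpace

namespace Literature.MathematicalPhysics.QuantumLattice

namespace PFB

variable {n : Type*} [Fintype n] [DecidableEq n]

/-! ## §1 The PFB inequality in free-energy form -/

/-- The thermal free energy `F_β(H) = −(1/β) log Z_β(H)` of a matrix Hamiltonian (real part of the
partition function `Matrix.partitionFn`; for Hermitian `H` the partition function is real and
positive, `partitionFn_eq_re`, `partitionFn_re_pos`). [cite: BratteliRobinsonII1997, §5.3.1] -/
def freeEnergy (β : ℝ) (H : Matrix n n ℂ) : ℝ :=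
  -Real.log (partitionFn β H).re / β

/-- Unfolding lemma for `freeEnergy` (`F = −β⁻¹ log Z`). [cite: BratteliRobinsonII1997, §5.3.1] -/
theorem freeEnergy_def (β : ℝ) (H : Matrix n n ℂ) :
    freeEnergy β H = -Real.log (partitionFn β H).re / β := rfl

/-- **Peierls–Feynman–Bogoliubov inequality (free-energy form).** For Hermitian `H`, `K` and
`β > 0`: `F_β(H) ≤ F_β(K) + Re⟨H − K⟩_{β,K}` — the functional `Φ̃ = F(K) + ⟨H − K⟩_K` of any trial
Hamiltonian `K` bounds the free energy of `H` from above. Derived from the tree's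
`Matrix.peierls_bogoliubov` (`Z(K+W) ≥ Z(K) e^{−β⟨W⟩_K}`) with `W = H − K`.
[cite: SchulerEtAl2013, Eq. (2)] -/
theorem freeEnergy_le_add_re_gibbsState [Nonempty n] {β : ℝ} (hβ : 0 < β) {H K : Matrix n n ℂ}
    (hH : H.IsHermitian) (hK : K.IsHermitian) :
    freeEnergy β H ≤ freeEnergy β K + (gibbsState β K (H - K)).re := by
  have hW : (H - K).IsHermitian := hH.sub hK
  have hPB := Matrix.peierls_bogoliubov hK hW β
  rw [add_sub_cancel] at hPB
  have hZK : 0 < (partitionFn β K).re := partitionFn_re_pos hK β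
  have hZH : 0 < (partitionFn β H).re := partitionFn_re_pos hH β
  -- take logarithms
  have hlog : Real.log (partitionFn β K).re + -(β * (gibbsState β K (H - K)).re) ≤
      Real.log (partitionFn β H).re := by
    have h := Real.log_le_log (mul_pos hZK (Real.exp_pos _)) hPB
    rwa [Real.log_mul hZK.ne' (Real.exp_pos _).ne', Real.log_exp] at h
  rw [freeEnergy, freeEnergy]
  have h1 : -Real.log (partitionFn β H).re ≤
      -Real.log (partitionFn β K).re + β * (gibbsState β K (H - K)).re := by linarith
  have h2 := div_le_div_of_nonneg_right h1 hβ.le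
  rw [add_div, mul_div_cancel_left₀ _ hβ.ne'] at h2
  exact h2

/-! ## §2 The extended / local Hubbard pair -/

/-- The extended Hamiltonian `H = T + U·D + V` (`T` one-body part, `D` the on-site double-occupancy
operator `Σ_l n_{l↑} n_{l↓}`, `V` the off-site interaction `½ Σ_{i≠j} V_ij n_i n_j` — here any
Hermitian matrices). [cite: SchulerEtAl2013, Eq. (1)] -/
def extH (T D V : Matrix n n ℂ) (U : ℝ) : Matrix n n ℂ :=
  T + (U : ℂ) • D + V

/-- The local (U-only) surrogate `K(Ũ) = T + Ũ·D`. [cite: SchulerEtAl2013, Eq. (1′)] -/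
def locH (T D : Matrix n n ℂ) (u : ℝ) : Matrix n n ℂ :=
  T + (u : ℂ) • D

/-- The PFB functional of the Hubbard pair,
`Φ̃(Ũ) = F_β(K(Ũ)) + (U − Ũ)·Re⟨D⟩_{β,K(Ũ)} + Re⟨V⟩_{β,K(Ũ)}`. [cite: SchulerEtAl2013, Eq. (2)] -/
def functional (β : ℝ) (T D V : Matrix n n ℂ) (U u : ℝ) : ℝ :=
  freeEnergy β (locH T D u) + (U - u) * (gibbsState β (locH T D u) D).re +
    (gibbsState β (locH T D u) V).re

omit [Fintype n] [DecidableEq n] in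
/-- The local surrogate `K(Ũ) = T + Ũ·D` is Hermitian for Hermitian `T`, `D`, real `Ũ`.
[cite: SchulerEtAl2013, Eq. (1)] -/
theorem isHermitian_locH {T D : Matrix n n ℂ} (hT : T.IsHermitian) (hD : D.IsHermitian) (u : ℝ) :
    (locH T D u).IsHermitian :=
  hT.add (isHermitian_real_smul hD u)

omit [Fintype n] [DecidableEq n] in
/-- The extended Hamiltonian `T + U·D + V` is Hermitian for Hermitian `T`, `D`, `V`, real `U`.
[cite: SchulerEtAl2013, Eq. (1)] -/
theorem isHermitian_extH {T D V : Matrix n n ℂ} (hT : T.IsHermitian) (hD : D.IsHermitian)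
    (hV : V.IsHermitian) (U : ℝ) : (extH T D V U).IsHermitian :=
  (hT.add (isHermitian_real_smul hD U)).add hV

omit [Fintype n] [DecidableEq n] in
/-- `H − K(Ũ) = (U − Ũ)·D + V`. [cite: SchulerEtAl2013, Eq. (2)] -/
theorem extH_sub_locH (T D V : Matrix n n ℂ) (U u : ℝ) :
    extH T D V U - locH T D u = ((U - u : ℝ) : ℂ) • D + V := by
  simp only [extH, locH, Complex.ofReal_sub, sub_smul]
  abel

/-- `Re⟨H − K(Ũ)⟩_{K(Ũ)} = (U − Ũ) Re⟨D⟩ + Re⟨V⟩` (linearity of the Gibbs state).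
[cite: SchulerEtAl2013, Eq. (2)] -/
theorem re_gibbsState_extH_sub_locH (β : ℝ) (T D V : Matrix n n ℂ) (U u : ℝ) :
    (gibbsState β (locH T D u) (extH T D V U - locH T D u)).re =
      (U - u) * (gibbsState β (locH T D u) D).re + (gibbsState β (locH T D u) V).re := by
  rw [extH_sub_locH, map_add, map_smul, Complex.add_re, smul_eq_mul, Complex.re_ofReal_mul]

/-- **The extended model's free energy is bounded by the PFB functional of EVERY local
surrogate**: `F_β(T + U·D + V) ≤ Φ̃(Ũ)` for all `Ũ`. [cite: SchulerEtAl2013, Eq. (2)] -/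
theorem freeEnergy_ext_le_functional [Nonempty n] {β : ℝ} (hβ : 0 < β) {T D V : Matrix n n ℂ}
    (hT : T.IsHermitian) (hD : D.IsHermitian) (hV : V.IsHermitian) (U u : ℝ) :
    freeEnergy β (extH T D V U) ≤ functional β T D V U u := by
  have h := freeEnergy_le_add_re_gibbsState hβ (isHermitian_extH hT hD hV U)
    (isHermitian_locH hT hD u)
  rw [re_gibbsState_extH_sub_locH] at h
  simpa [functional, add_assoc] using h

/-- Hence the optimal local model is the minimiser of `Φ̃`; in particular the infimum of `Φ̃` over
`Ũ` still bounds `F_β(H)`. [cite: SchulerEtAl2013, Eq. (2)] -/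
theorem freeEnergy_ext_le_iInf_functional [Nonempty n] {β : ℝ} (hβ : 0 < β)
    {T D V : Matrix n n ℂ} (hT : T.IsHermitian) (hD : D.IsHermitian) (hV : V.IsHermitian) (U : ℝ) :
    freeEnergy β (extH T D V U) ≤ ⨅ u : ℝ, functional β T D V U u :=
  le_ciInf fun u => freeEnergy_ext_le_functional hβ hT hD hV U u

/-! ## §3 Thermal Hellmann–Feynman: `dF(K(Ũ))/dŨ = Re⟨D⟩` -/

omit [Fintype n] [DecidableEq n] in
/-- Exponent bookkeeping: `−β·K(Ũ) = −β·T + Ũ·(−β·D)` (the straight line along which the Duhamel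
derivative is taken). [cite: BratteliRobinsonII1997, §5.3.1] -/
theorem neg_smul_locH (β : ℝ) (T D : Matrix n n ℂ) (u : ℝ) :
    -(β : ℂ) • locH T D u = -(β : ℂ) • T + u • (-(β : ℂ) • D) := by
  rw [locH, ← Complex.coe_smul]
  module

/-- `e^{−βK(Ũ)} = exp(−βT + Ũ·(−βD))`. [cite: BratteliRobinsonII1997, §5.3.1] -/
theorem gibbsWeight_locH (β : ℝ) (T D : Matrix n n ℂ) (u : ℝ) :
    gibbsWeight β (locH T D u) = exp (-(β : ℂ) • T + u • (-(β : ℂ) • D)) := by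
  rw [gibbsWeight, neg_smul_locH]

/-- **Thermal Hellmann–Feynman theorem**: for Hermitian `T`, `D` and `β > 0`,
`Ũ ↦ F_β(T + Ũ·D)` is differentiable with derivative `Re⟨D⟩_{β, T + Ũ·D}` (first-order
perturbation theory of `log Z`, via the Duhamel derivative `hasDerivAt_re_trace_exp_add_smul`).
[cite: BratteliRobinsonII1997, §5.3.1] -/
theorem hasDerivAt_freeEnergy_loc [Nonempty n] {β : ℝ} (hβ : 0 < β) {T D : Matrix n n ℂ}
    (hT : T.IsHermitian) (hD : D.IsHermitian) (u₀ : ℝ) :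
    HasDerivAt (fun u : ℝ => freeEnergy β (locH T D u)) ((gibbsState β (locH T D u₀) D).re) u₀ := by
  set A : Matrix n n ℂ := -(β : ℂ) • T with hA
  set Y : Matrix n n ℂ := -(β : ℂ) • D with hY
  set Z : ℝ → ℝ := fun u => (exp (A + u • Y)).trace.re with hZdef
  have hKh : ∀ u : ℝ, (locH T D u).IsHermitian := fun u => isHermitian_locH hT hD u
  have hZu : ∀ u : ℝ, Z u = (partitionFn β (locH T D u)).re := by
    intro u
    simp only [hZdef, hA, hY, partitionFn, gibbsWeight_locH]
  have hZpos : ∀ u, 0 < Z u := fun u => by rw [hZu]; exact partitionFn_re_pos (hKh u) β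
  -- `Z' = Re tr(Y e^{A + u Y}) = -β Z Re⟨D⟩`
  have hZ' : HasDerivAt Z ((Y * exp (A + u₀ • Y)).trace.re) u₀ :=
    hasDerivAt_re_trace_exp_add_smul A Y u₀
  have hN : (Y * exp (A + u₀ • Y)).trace.re = -(β * (Z u₀ * (gibbsState β (locH T D u₀) D).re)) := by
    have hZc : partitionFn β (locH T D u₀) = ((Z u₀ : ℝ) : ℂ) := by
      rw [hZu]; exact partitionFn_eq_re (hKh u₀) β
    have hZne : (Z u₀ : ℂ) ≠ 0 := by exact_mod_cast (hZpos u₀).ne'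
    have hg : gibbsState β (locH T D u₀) D = (Z u₀ : ℂ)⁻¹ * (exp (A + u₀ • Y) * D).trace := by
      rw [gibbsState_apply, hZc, gibbsWeight_locH]
    have htr : (Y * exp (A + u₀ • Y)).trace = -(β : ℂ) * (exp (A + u₀ • Y) * D).trace := by
      rw [hY, Matrix.smul_mul, trace_smul, smul_eq_mul, trace_mul_comm]
    have hkey : (Y * exp (A + u₀ • Y)).trace =
        -(β : ℂ) * ((Z u₀ : ℂ) * gibbsState β (locH T D u₀) D) := by
      rw [htr, hg, ← mul_assoc (Z u₀ : ℂ), mul_inv_cancel₀ hZne, one_mul]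
    rw [hkey]
    simp [Complex.mul_re, Complex.neg_re]
  rw [hN] at hZ'
  -- `F = -log Z / β`
  have hF : (fun u : ℝ => freeEnergy β (locH T D u)) = fun u => -Real.log (Z u) / β := by
    funext u; rw [freeEnergy, hZu]
  rw [hF]
  have hlog : HasDerivAt (fun u => Real.log (Z u))
      (-(β * (Z u₀ * (gibbsState β (locH T D u₀) D).re)) / Z u₀) u₀ :=
    hZ'.log (hZpos u₀).ne'
  have h := (hlog.neg).div_const β
  refine h.congr_deriv ?_
  field_simp [(hZpos u₀).ne', hβ.ne']

/-! ## §4 The derivative of the PFB functional and Schüler's stationarity formula -/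

/-- **`Φ̃′(Ũ) = (U − Ũ)·∂_Ũ Re⟨D⟩ + ∂_Ũ Re⟨V⟩`** — the two `Re⟨D⟩` terms produced by
differentiating `F(K(Ũ))` (§3) and `−Ũ·Re⟨D⟩` cancel. The derivatives `d`, `c` of the two
correlators are supplied as hypotheses (they exist, e.g. by the linear-response formula
`Matrix.hasDerivAt_gibbsState_add_smul_real`; Schüler evaluates them by DQMC/ED, van Loon by
DQMC/DB/DMFT/RPA). [cite: SchulerEtAl2013, Eq. (3)] -/
theorem hasDerivAt_functional [Nonempty n] {β : ℝ} (hβ : 0 < β) {T D V : Matrix n n ℂ}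
    (hT : T.IsHermitian) (hD : D.IsHermitian) (U : ℝ) {u₀ d c : ℝ}
    (hd : HasDerivAt (fun u : ℝ => (gibbsState β (locH T D u) D).re) d u₀)
    (hc : HasDerivAt (fun u : ℝ => (gibbsState β (locH T D u) V).re) c u₀) :
    HasDerivAt (fun u : ℝ => functional β T D V U u) ((U - u₀) * d + c) u₀ := by
  have hF := hasDerivAt_freeEnergy_loc hβ hT hD u₀
  have hlin : HasDerivAt (fun u : ℝ => U - u) (-1) u₀ := by
    simpa using (hasDerivAt_id u₀).const_sub U
  have hprod := hlin.mul hd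
  have h := (hF.add hprod).add hc
  refine h.congr_deriv ?_
  ring

/-- **Schüler's formula.** At a stationary point of `Φ̃` with `∂_Ũ Re⟨D⟩ ≠ 0`:
`Φ̃′(Ũ) = 0 ↔ Ũ = U + ∂_Ũ Re⟨V⟩ / ∂_Ũ Re⟨D⟩` — with `D = Σ_l n_{l↑}n_{l↓}` and
`V = ½ Σ_{i≠j,σσ′} V_ij n_{iσ} n_{jσ′}` this is
`U⋆ = U + ½ Σ_{i≠j} V_ij ∂⟨n_i n_j⟩⋆ / Σ_l ∂⟨n_{l↑} n_{l↓}⟩⋆`, i.e. `U⋆ = U − V̄` with `V̄` the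
(positive) weighted average of the off-site terms, since `∂⟨n↑n↓⟩ < 0 < ∂⟨n_i n_j⟩`.
[cite: SchulerEtAl2013, Eq. (3)] -/
theorem stationary_iff (U : ℝ) {u₀ d c : ℝ} (hd : d ≠ 0) :
    (U - u₀) * d + c = 0 ↔ u₀ = U + c / d := by
  constructor
  · intro h
    have : c = -((U - u₀) * d) := by linarith
    rw [this, neg_div, mul_div_cancel_right₀ _ hd]
    ring
  · intro h
    rw [h]
    field_simp
    ring

/-- The two statements together: if `Φ̃` is stationary at `Ũ` (e.g. at an interior minimiser) and
the double occupancy responds (`d ≠ 0`), then `Ũ = U + c/d`. [cite: SchulerEtAl2013, Eq. (3)] -/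
theorem optimalU_of_stationary [Nonempty n] {β : ℝ} (hβ : 0 < β) {T D V : Matrix n n ℂ}
    (hT : T.IsHermitian) (hD : D.IsHermitian) (U : ℝ) {u₀ d c : ℝ}
    (hd : HasDerivAt (fun u : ℝ => (gibbsState β (locH T D u) D).re) d u₀)
    (hc : HasDerivAt (fun u : ℝ => (gibbsState β (locH T D u) V).re) c u₀)
    (hstat : deriv (fun u : ℝ => functional β T D V U u) u₀ = 0) (hd0 : d ≠ 0) :
    u₀ = U + c / d := by
  have h := (hasDerivAt_functional hβ hT hD U hd hc).deriv
  rw [h] at hstat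
  exact (stationary_iff U hd0).mp hstat

/-- A necessary condition at an interior MINIMISER of `Φ̃` (Fermat): the derivative vanishes, so
Schüler's formula holds there. [cite: SchulerEtAl2013, Eq. (2)–(3)] -/
theorem optimalU_of_isLocalMin [Nonempty n] {β : ℝ} (hβ : 0 < β) {T D V : Matrix n n ℂ}
    (hT : T.IsHermitian) (hD : D.IsHermitian) (U : ℝ) {u₀ d c : ℝ}
    (hd : HasDerivAt (fun u : ℝ => (gibbsState β (locH T D u) D).re) d u₀)
    (hc : HasDerivAt (fun u : ℝ => (gibbsState β (locH T D u) V).re) c u₀)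
    (hmin : IsLocalMin (fun u : ℝ => functional β T D V U u) u₀) (hd0 : d ≠ 0) :
    u₀ = U + c / d := by
  have h0 : (U - u₀) * d + c = 0 :=
    hmin.hasDerivAt_eq_zero (hasDerivAt_functional hβ hT hD U hd hc)
  exact (stationary_iff U hd0).mp h0

/-! ## §5 The printed evaluations of the formula -/

/-- **Nearest-neighbour displacement ⇒ `U⋆ = U − V₀₁`.** Per site of a translation-invariant
lattice with coordination number `N_n` and `N` sites: if an increase of `Ũ` displaces electrons
only to nearest neighbours, the sum rule gives `∂⟨n_{0↑}n_{0↓}⟩ = −N_n·s₁` with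
`s₁ = Σ_{σ′} ∂⟨n_{0↑} n_{1σ′}⟩`, while the off-site correlator derivative is `N·N_n·V₀₁·s₁`; then
`U + c/d = U − V₀₁` («severe approximation … close to the exact ones in a wide doping range around
half filling»). [cite: SchulerEtAl2013, Eq. (5)] -/
theorem optimalU_nn_displacement (U V₀₁ N Nn s₁ : ℝ) (hN : N ≠ 0) (hNn : Nn ≠ 0) (hs : s₁ ≠ 0) :
    U + (N * (Nn * V₀₁ * s₁)) / (N * (-(Nn * s₁))) = U - V₀₁ := by
  field_simp
  ring

/-- **van Loon's `α`-form**: with a single nearest-neighbour shell `V₀j = V` the formula reads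
`Ũ = U − α·V`, `α := −c₁/d` where `c₁` is the derivative of the nearest-neighbour correlator sum
and `d` that of the double occupancy (`α(Ũ) → 1` only for `Ũ ≫ t`; minimum at intermediate `Ũ`).
[cite: vanLoonEtAl2016, §2 Eqs. (5)–(6)] -/
theorem optimalU_alpha_form (U V c₁ d : ℝ) :
    U + (V * c₁) / d = U - (-(c₁ / d)) * V := by
  ring

/-! ## §6 Zero temperature: enclosure of the extended model's ground energy by local-model data -/

/-- **T = 0 form of the PFB bound** (the variational principle with the tracial ground state of the
local surrogate as trial state): for every `Ũ`,
`E₀(T + U·D + V) ≤ E₀(K(Ũ)) + (U − Ũ)·Re ω_{K(Ũ)}(D) + Re ω_{K(Ũ)}(V)`, `ω_K` = the tracial ground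
state of `K(Ũ) = T + Ũ·D` (`Matrix.groundStateFunctional`) — the `β → ∞` limit of §2.
[cite: SchulerEtAl2013, Eq. (2)] -/
theorem groundEnergy_ext_le [Nonempty n] {T D V : Matrix n n ℂ} (hT : T.IsHermitian)
    (hD : D.IsHermitian) (hV : V.IsHermitian) (U u : ℝ) :
    (extH T D V U).groundEnergy ≤ (locH T D u).groundEnergy +
      (U - u) * ((locH T D u).groundStateFunctional D).re +
        ((locH T D u).groundStateFunctional V).re := by
  have h := Matrix.groundEnergy_le_groundStateFunctional_re (isHermitian_locH hT hD u)
    (isHermitian_extH hT hD hV U)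
  have hsplit : extH T D V U = locH T D u + (((U - u : ℝ) : ℂ) • D + V) := by
    rw [← extH_sub_locH]; abel
  have hω : ((locH T D u).groundStateFunctional (extH T D V U)).re =
      (locH T D u).groundEnergy + ((U - u) * ((locH T D u).groundStateFunctional D).re +
        ((locH T D u).groundStateFunctional V).re) := by
    rw [hsplit, map_add, map_add, map_smul,
      Matrix.groundStateFunctional_hamiltonian (isHermitian_locH hT hD u)]
    simp [Complex.add_re, smul_eq_mul]
  rw [hω] at h
  linarith

/-- **Lower side at the same `U`**: if the off-site part is a nonnegative operator (`V ⪰ 0`, as for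
`½ Σ V_ij n_i n_j` with `V_ij ≥ 0`), then `E₀(T + U·D) ≤ E₀(T + U·D + V)` (the tracial ground
state of the extended model is a trial state for the local one and `ω(V) ≥ 0`).
[cite: Tasaki2020, §2.1 (2.1.6)] -/
theorem groundEnergy_loc_le_ext [Nonempty n] {T D V : Matrix n n ℂ} (hT : T.IsHermitian)
    (hD : D.IsHermitian) (hV : V.IsHermitian) (hVpos : V.PosSemidef) (U : ℝ) :
    (locH T D U).groundEnergy ≤ (extH T D V U).groundEnergy := by
  have h := Matrix.groundEnergy_le_groundStateFunctional_re (isHermitian_extH hT hD hV U)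
    (isHermitian_locH hT hD U)
  have hK : locH T D U = extH T D V U - V := by simp [extH, locH]
  rw [hK, map_sub, Matrix.groundStateFunctional_hamiltonian (isHermitian_extH hT hD hV U)] at h
  have hVnn := Matrix.groundStateFunctional_nonneg_of_posSemidef (extH T D V U) hVpos
  obtain ⟨hre, -⟩ := Complex.nonneg_iff.mp hVnn
  simp only [Complex.sub_re, Complex.ofReal_re] at h hre
  rw [← hK] at h
  linarith

/-- **Two-sided enclosure by U-only data** (`V ⪰ 0`): with the local model at the SAME `U`,
`E₀(K(U)) ≤ E₀(T + U·D + V) ≤ E₀(K(U)) + Re ω_{K(U)}(V)` — a certified ground energy and ONE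
certified ground-state expectation of the U-only model enclose the extended model's ground energy.
[cite: SchulerEtAl2013, Eq. (2)] -/
theorem groundEnergy_ext_mem_Icc [Nonempty n] {T D V : Matrix n n ℂ} (hT : T.IsHermitian)
    (hD : D.IsHermitian) (hV : V.IsHermitian) (hVpos : V.PosSemidef) (U : ℝ) :
    (extH T D V U).groundEnergy ∈ Set.Icc (locH T D U).groundEnergy
      ((locH T D U).groundEnergy + ((locH T D U).groundStateFunctional V).re) := by
  refine ⟨groundEnergy_loc_le_ext hT hD hV hVpos U, ?_⟩
  have h := groundEnergy_ext_le hT hD hV U U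
  simpa using h

end PFB

end Literature.MathematicalPhysics.QuantumLattice
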